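import Summits.SmoothPoincare4.SmoothPoincare4.Theorems.SblfDescentRungOne
import Summits.SmoothPoincare4.SmoothPoincare4.Theorems.SblfDescentSblfExistsShield
import Literature.Topology.FourManifolds.SurgeryGluck
import Literature.Topology.FourManifolds.GluckTwistHomotopySphereProofs

/-!
# fwd-ladder gen 14 on seed stmt-SmoothPoincare4-18530 (`SblfDescent.SblfExists`) — dial P67, typed

The GLUCK-TWIST CELL of the existence ladder of `SblfExists` (restrict the bound manifold `M` to
Gluck twists of `S⁴`, instantiate the lower genus `h := 0`):

  `GluckSblfZero` : every Gluck twist `X` of `S⁴` along a 2-knot `K` admits a simplified broken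
  Lefschetz fibration of lower genus `0` (genus one, non-empty round locus).

Kernel-checked placement (no `sorry`):
* `gluckSblfZero_of_smoothPoincare4`      : `SmoothPoincare4 → GluckSblfZero`            (on-path, S ⇒ rung);
* `gluckSblfZero_of_gluckTwistConjecture` : `GluckTwistConjecture.{0} → GluckSblfZero`   (the registered
  conjecture `Literature.Topology.FourManifolds.GluckTwistConjecture`, Kirby 4.24, dominates the rung);
* `gluckTwistConjecture_of_gluckSblfZero_of_rungOne` : `RungOne → GluckSblfZero → GluckTwistConjecture.{0}`
  (with the route's genus-one rung = Hayano's classification, the rung gives the conjecture back);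
* `gluckSblfZero_iff_gluckTwistConjecture_of_rungOne` : modulo `RungOne`, the cell IS Kirby Problem 4.24.

Tribunal forward kernel (tier quick, probe engine-de122c92, 2026-08-19T04:57:35Z, floor
`Theorems.exists_sblf_zero_of_diffeomorph_sphere_four`): `tk=PROVISIONAL`, t1 kernel clean, real_step TRUE,
`t1a-converse-only:…:gluckSblfZero_of_smoothPoincare4` (on-path lemma seen as landed),
`t1a-info:GluckSblfZero:iff-other:GluckTwistConjecture:gluckSblfZero_iff_gluckTwistConjecture_of_rungOne`
(the kernel sees the costume), chips t2-named-open-problem / t1c-print-placement.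

Verdict recorded in LADDER-SblfExists.md §20: critic-rejected (costume of the tree conjecture
`GluckTwistConjecture`, Kirby 4.24; C0 R4 A1 L1 B3 K1, predicted C).  This file is banked evidence, not a
line: it registers no stubs; the two bridge lemmas are reusable.
-/

set_option linter.dupNamespace false

namespace Summit.SmoothPoincare4.SmoothPoincare4.Cruxes.SblfExists.GluckCell

open scoped Manifold ContDiff Topology ContinuousMap
open Literature.Topology.FourManifolds

/-- Dial P67 (gen 14): the Gluck-twist cell of the existence ladder of `SblfExists` at lower genus `0`:
every Gluck twist of `S⁴` (a Hausdorff second-countable smooth `X : Type` with `IsGluckTwist (𝓡 4) X K`)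
carries a simplified broken Lefschetz fibration `IsSimplifiedBrokenLefschetzFibration o f L 0`. -/
def GluckSblfZero : Prop :=
  ∀ (K : TwoKnot) (X : Type) [TopologicalSpace X] [T2Space X] [SecondCountableTopology X]
    [ChartedSpace (EuclideanSpace ℝ (Fin 4)) X] [IsManifold (𝓡 4) ∞ X],
    IsGluckTwist (𝓡 4) X K →
    ∃ (o : SmoothOrientation (𝓡 4) X) (f : X → Metric.sphere (0 : EuclideanSpace ℝ (Fin 3)) 1)
      (L : Finset X), IsSimplifiedBrokenLefschetzFibration o f L 0

/-- ON-PATH: `S ⇒ rung`.  Under SPC4 a Gluck twist (a homotopy 4-sphere,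
`IsGluckTwist.nonempty_homotopyEquiv_sphere`, proved) is diffeomorphic to `S⁴` and carries the
transported ADK fibration (`exists_sblf_zero_of_diffeomorph_sphere_four`, proved). -/
theorem gluckSblfZero_of_smoothPoincare4 (hS : _root_.SmoothPoincare4) : GluckSblfZero := by
  intro K X _ _ _ _ _ hX
  obtain ⟨e⟩ := hX.nonempty_homotopyEquiv_sphere
  obtain ⟨Φ⟩ := hS X ‹_› ‹_› e
  obtain ⟨o, f, hf⟩ := Theorems.exists_sblf_zero_of_diffeomorph_sphere_four X Φ
  exact ⟨o, f, ∅, hf⟩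

/-- DOMINATION by a registered conjecture: `GluckTwistConjecture ⇒ rung` (same transport). -/
theorem gluckSblfZero_of_gluckTwistConjecture (hG : GluckTwistConjecture.{0}) : GluckSblfZero := by
  intro K X _ _ _ _ _ hX
  obtain ⟨Φ⟩ := hG K X hX
  obtain ⟨o, f, hf⟩ := Theorems.exists_sblf_zero_of_diffeomorph_sphere_four X Φ
  exact ⟨o, f, ∅, hf⟩

/-- CONVERSE modulo the route's genus-one rung (`RungOne`, support item stmt-SmoothPoincare4-18531 =
Hayano 2011 Cor. 4.11 as a named fact): a Gluck twist carrying a lower-genus-0 SBLF is `S⁴`. -/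
theorem gluckTwistConjecture_of_gluckSblfZero_of_rungOne
    (h1 : Theses.SblfDescent.RungOne) (hZ : GluckSblfZero) : GluckTwistConjecture.{0} := by
  intro K X _ _ _ _ _ hX
  obtain ⟨e⟩ := hX.nonempty_homotopyEquiv_sphere
  exact h1 X e ((Theorems.sblfDescent_has_zero_iff X).mp (hZ K X hX))

/-- The Gluck-twist cell of the existence ladder of `SblfExists` IS Kirby Problem 4.24, modulo `RungOne`. -/
theorem gluckSblfZero_iff_gluckTwistConjecture_of_rungOne (h1 : Theses.SblfDescent.RungOne) :
    GluckSblfZero ↔ GluckTwistConjecture.{0} :=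
  ⟨gluckTwistConjecture_of_gluckSblfZero_of_rungOne h1, gluckSblfZero_of_gluckTwistConjecture⟩

/-- Unconditional form of the converse direction, through Hayano's named fact directly
(`RungOne_of_sblfGenusOne`). -/
theorem gluckTwistConjecture_of_gluckSblfZero
    (H : nonempty_diffeomorph_sphere_four_of_sblf_genus_one) (hZ : GluckSblfZero) :
    GluckTwistConjecture.{0} :=
  gluckTwistConjecture_of_gluckSblfZero_of_rungOne (Theorems.RungOne_of_sblfGenusOne H) hZ

end Summit.SmoothPoincare4.SmoothPoincare4.Cruxes.SblfExists.GluckCell
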